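import Literature.Barriers.AtomisticToContinuum.HardDiskDeformationProfile
import Literature.Barriers.AtomisticToContinuum.HardDiskBoxGeometry
import HarnessLib

/-!
# The two-dimensional estimates (6.16)–(6.18) on the deformation profile (Richthammer 2007, §6.8)

Companion of `HardDiskDeformationProfile.lean` and `HardDiskBoxGeometry.lean` (provefact
`Literature.Barriers.AtomisticToContinuum.HardDisk.Richthammer2007_hardDisk`): the estimates that
feed the bound `μ(G_nᶜ) ≤ δ` on the bad configurations (Lemma 13), all proved.

* `lintegral_box_qFun_sq_le` — **(6.16), up to constants**:
  `∫_{Λ_N} q(|x| - R̄)² dx ≤ 8J² + 36 Q(N - R̄)` with `J = ⌈2R̄⌉ + 4` (printed: `16R̄² + 32Q(n̄ - R̄)`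
  for `n̄ ≥ 2R̄`; the constants play no role). Proof as printed, with the square shells
  `{j ≤ |x| < j+1}` of area `8j + 4` in place of "`ds 8s`": on the shell, `q(|x| - R̄) ≤ q(j - R̄)`
  (`q` decreasing); for `j < J` use `q ≤ 1`, for `j ≥ J ≥ 2R̄` use `u q(u) ≤ 2`, `q ≤ 1`
  (`u = j - R̄ ≥ j/2`) to get `(8j+4) q(u)² ≤ 36 q(u)`, and `∑_j q(j - R̄) ≤ ∫ q = Q` by
  monotonicity [Richthammer2007, §6.8 (6.16)];
* `tendsto_cFun_zero` — **(6.17)**: `c(N) := ∫_{Λ_N} q(|x| - R̄)² dx / Q(N - R̄)² → 0` as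
  `N → ∞`, since `Q → ∞` [Richthammer2007, §6.8 (6.17)];
* `sq_sub_add_le` — **(6.18)**: `(|x_m| - |x₀| + c_K)² ≤ (m+1)² c_K²` for a chain with steps of
  maximum norm `≤ c_K` [Richthammer2007, §6.8 (6.18)].

## References

* [Richthammer2007] T. Richthammer, *Translation-invariance of two-dimensional Gibbsian point
  processes*, Comm. Math. Phys. 274 (2007) 81–122, arXiv:0706.3637: §6.8 (p. 17), (6.16)–(6.18).
-/

noncomputable section

open MeasureTheory Set Filter
open scoped ENNReal Topology

namespace Literature.Barriers.AtomisticToContinuum.HardDisk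

/-- The plane. -/
local notation "E2" => EuclideanSpace ℝ (Fin 2)

/-! ### Square shells -/

/-- The square shell `{j ≤ |x| < j + 1}`. [folklore] -/
def shell (j : ℕ) : Set E2 := {x | (j : ℝ) ≤ supNorm x ∧ supNorm x < j + 1}

/-- Shells are measurable. [folklore] -/
theorem measurableSet_shell (j : ℕ) : MeasurableSet (shell j) :=
  (measurableSet_le measurable_const measurable_supNorm).inter
    (measurableSet_lt measurable_supNorm measurable_const)

/-- The shell as a difference of two open squares. [folklore] -/
theorem shell_eq (j : ℕ) :
    shell j = {x : E2 | supNorm x < j + 1} \ {x : E2 | supNorm x < j} := by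
  ext x
  simp only [shell, Set.mem_setOf_eq, Set.mem_sdiff, not_lt]
  tauto

/-- **The area of a shell is at most `8j + 4`** (`= (2(j+1))² - (2j)²`). [folklore] -/
theorem volume_shell_le (j : ℕ) : volume (shell j) ≤ ENNReal.ofReal (8 * j + 4) := by
  rw [shell_eq]
  rcases Nat.eq_zero_or_pos j with rfl | hj
  · calc volume ({x : E2 | supNorm x < (0 : ℕ) + 1} \ {x : E2 | supNorm x < (0 : ℕ)})
        ≤ volume {x : E2 | supNorm x < (0 : ℕ) + 1} := measure_mono Set.sdiff_subset
      _ = ENNReal.ofReal (8 * (0 : ℕ) + 4) := by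
          rw [Nat.cast_zero, zero_add, volume_setOf_supNorm_lt one_pos]
          norm_num
  · have hjpos : (0 : ℝ) < j := by exact_mod_cast hj
    have hsub : {x : E2 | supNorm x < j} ⊆ {x : E2 | supNorm x < j + 1} := by
      intro x hx
      simp only [Set.mem_setOf_eq] at hx ⊢
      linarith
    rw [measure_sdiff hsub (measurableSet_setOf_supNorm_lt _).nullMeasurableSet
      (by rw [volume_setOf_supNorm_lt hjpos]; exact ENNReal.ofReal_ne_top),
      volume_setOf_supNorm_lt hjpos, volume_setOf_supNorm_lt (by linarith),
      ← ENNReal.ofReal_sub _ (by positivity)]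
    refine ENNReal.ofReal_le_ofReal (le_of_eq ?_)
    ring

/-! ### (6.16) -/

/-- The real-variable core of (6.16): with `J = ⌈2R̄⌉ + 4`,
`∑_{j<M} (8j+4) q(j - R̄)² ≤ 8J² + 36 Q(M - 1 - R̄)` whenever `J ≤ M`; and `≤ 8J²` if `M ≤ J`.
[cite: Richthammer2007, §6.8 (6.16) (p. 17)] -/
theorem sum_shell_qFun_sq_le (Rb : ℝ) (M : ℕ) :
    ∑ j ∈ Finset.range M, (8 * (j : ℝ) + 4) * qFun (j - Rb) ^ 2 ≤
      8 * ((⌈2 * Rb⌉₊ : ℝ) + 4) ^ 2 + 36 * max 0 (QFun ((M : ℝ) - 1 - Rb)) := by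
  set J : ℕ := ⌈2 * Rb⌉₊ + 4 with hJ
  have hJreal : (J : ℝ) = (⌈2 * Rb⌉₊ : ℝ) + 4 := by rw [hJ]; push_cast; ring
  have hJge : 2 * Rb + 4 ≤ (J : ℝ) := by rw [hJreal]; linarith [Nat.le_ceil (2 * Rb)]
  -- head: `j < J`
  have hhead : ∀ j : ℕ, j < J → (8 * (j : ℝ) + 4) * qFun (j - Rb) ^ 2 ≤ 8 * J := by
    intro j hj
    have hq : qFun (j - Rb) ^ 2 ≤ 1 := by
      have h1 := qFun_le_one ((j : ℝ) - Rb)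
      have h0 := (qFun_pos ((j : ℝ) - Rb)).le
      nlinarith
    have hj' : (j : ℝ) + 1 ≤ J := by exact_mod_cast hj
    calc (8 * (j : ℝ) + 4) * qFun (j - Rb) ^ 2 ≤ (8 * (j : ℝ) + 4) * 1 :=
          mul_le_mul_of_nonneg_left hq (by positivity)
      _ ≤ 8 * J := by linarith
  -- tail: `J ≤ j`
  have htail : ∀ j : ℕ, J ≤ j → (8 * (j : ℝ) + 4) * qFun (j - Rb) ^ 2 ≤ 36 * qFun (j - Rb) := by
    intro j hj
    have hj' : (J : ℝ) ≤ j := by exact_mod_cast hj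
    set u : ℝ := j - Rb with hu
    have hu0 : 0 ≤ u := by rw [hu]; linarith
    have hju : 8 * (j : ℝ) + 4 ≤ 16 * u + 4 := by rw [hu]; linarith
    have h1 := mul_qFun_le_two hu0
    have h2 := qFun_le_one u
    have h3 := (qFun_pos u).le
    calc (8 * (j : ℝ) + 4) * qFun u ^ 2 ≤ (16 * u + 4) * qFun u ^ 2 :=
          mul_le_mul_of_nonneg_right hju (sq_nonneg _)
      _ = 16 * (u * qFun u) * qFun u + 4 * qFun u * qFun u := by ring
      _ ≤ 16 * 2 * qFun u + 4 * 1 * qFun u := by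
          gcongr
      _ = 36 * qFun u := by ring
  -- the tail sum is bounded by the integral
  have hsum_tail : ∀ M : ℕ, J ≤ M →
      ∑ j ∈ Finset.Ico J M, qFun ((j : ℝ) - Rb) ≤ max 0 (QFun ((M : ℝ) - 1 - Rb)) := by
    intro M hJM
    -- `q(j - R̄) ≤ ∫_{j-1}^{j} q(s - R̄) ds`
    have hterm : ∀ j : ℕ, qFun ((j : ℝ) - Rb) ≤ ∫ s in ((j : ℝ) - 1 - Rb)..((j : ℝ) - Rb), qFun s := by
      intro j
      have h := intervalIntegral.integral_mono_on (show (j : ℝ) - 1 - Rb ≤ (j : ℝ) - Rb by linarith)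
        (intervalIntegrable_const (c := qFun ((j : ℝ) - Rb))) (intervalIntegrable_qFun _ _)
        (fun s hs => qFun_antitone hs.2)
      rw [intervalIntegral.integral_const, smul_eq_mul] at h
      have e : ((j : ℝ) - Rb - ((j : ℝ) - 1 - Rb)) = 1 := by ring
      rw [e, one_mul] at h
      exact h
    -- telescope
    have htel : ∑ j ∈ Finset.Ico J M, ∫ s in ((j : ℝ) - 1 - Rb)..((j : ℝ) - Rb), qFun s =
        ∫ s in ((J : ℝ) - 1 - Rb)..((M : ℝ) - 1 - Rb), qFun s := by
      have key : ∀ m : ℕ, ∑ j ∈ Finset.Ico J (J + m), ∫ s in ((j : ℝ) - 1 - Rb)..((j : ℝ) - Rb), qFun s =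
          ∫ s in ((J : ℝ) - 1 - Rb)..((J : ℝ) + m - 1 - Rb), qFun s := by
        intro m
        induction m with
        | zero => simp
        | succ m ih =>
          rw [← Nat.add_assoc, Finset.sum_Ico_succ_top (Nat.le_add_right J m), ih]
          push_cast
          have e : (J : ℝ) + ((m : ℝ) + 1) - 1 - Rb = (J : ℝ) + m - Rb := by ring
          rw [e]
          exact intervalIntegral.integral_add_adjacent_intervals (intervalIntegrable_qFun _ _)
            (intervalIntegrable_qFun _ _)
      obtain ⟨m, rfl⟩ := Nat.exists_eq_add_of_le hJM
      rw [key m]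
      push_cast
      ring_nf
    calc ∑ j ∈ Finset.Ico J M, qFun ((j : ℝ) - Rb)
        ≤ ∑ j ∈ Finset.Ico J M, ∫ s in ((j : ℝ) - 1 - Rb)..((j : ℝ) - Rb), qFun s :=
          Finset.sum_le_sum fun j _ => hterm j
      _ = ∫ s in ((J : ℝ) - 1 - Rb)..((M : ℝ) - 1 - Rb), qFun s := htel
      _ = QFun ((M : ℝ) - 1 - Rb) - QFun ((J : ℝ) - 1 - Rb) := by
          unfold QFun
          rw [← intervalIntegral.integral_add_adjacent_intervals (intervalIntegrable_qFun 0 ((J : ℝ) - 1 - Rb))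
            (intervalIntegrable_qFun ((J : ℝ) - 1 - Rb) ((M : ℝ) - 1 - Rb))]
          ring
      _ ≤ max 0 (QFun ((M : ℝ) - 1 - Rb)) := by
          have : 0 ≤ QFun ((J : ℝ) - 1 - Rb) := QFun_nonneg (by linarith)
          exact le_trans (by linarith) (le_max_right _ _)
  -- assemble
  rcases le_or_gt J M with hJM | hJM
  · rw [← Finset.sum_range_add_sum_Ico _ hJM]
    have h1 : ∑ j ∈ Finset.range J, (8 * (j : ℝ) + 4) * qFun (j - Rb) ^ 2 ≤ 8 * (J : ℝ) ^ 2 := by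
      calc ∑ j ∈ Finset.range J, (8 * (j : ℝ) + 4) * qFun (j - Rb) ^ 2
          ≤ ∑ _j ∈ Finset.range J, (8 * (J : ℝ)) := Finset.sum_le_sum fun j hj => hhead j (Finset.mem_range.1 hj)
        _ = 8 * (J : ℝ) ^ 2 := by rw [Finset.sum_const, Finset.card_range, nsmul_eq_mul]; ring
    have h2 : ∑ j ∈ Finset.Ico J M, (8 * (j : ℝ) + 4) * qFun (j - Rb) ^ 2 ≤
        36 * max 0 (QFun ((M : ℝ) - 1 - Rb)) := by
      calc ∑ j ∈ Finset.Ico J M, (8 * (j : ℝ) + 4) * qFun (j - Rb) ^ 2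
          ≤ ∑ j ∈ Finset.Ico J M, 36 * qFun ((j : ℝ) - Rb) :=
            Finset.sum_le_sum fun j hj => htail j (Finset.mem_Ico.1 hj).1
        _ = 36 * ∑ j ∈ Finset.Ico J M, qFun ((j : ℝ) - Rb) := by rw [Finset.mul_sum]
        _ ≤ 36 * max 0 (QFun ((M : ℝ) - 1 - Rb)) := by
            exact mul_le_mul_of_nonneg_left (hsum_tail M hJM) (by norm_num)
    rw [← hJreal]
    linarith
  · have h1 : ∑ j ∈ Finset.range M, (8 * (j : ℝ) + 4) * qFun (j - Rb) ^ 2 ≤ 8 * (J : ℝ) ^ 2 := by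
      calc ∑ j ∈ Finset.range M, (8 * (j : ℝ) + 4) * qFun (j - Rb) ^ 2
          ≤ ∑ _j ∈ Finset.range M, (8 * (J : ℝ)) :=
            Finset.sum_le_sum fun j hj => hhead j ((Finset.mem_range.1 hj).trans hJM)
        _ = (M : ℝ) * (8 * J) := by rw [Finset.sum_const, Finset.card_range, nsmul_eq_mul]
        _ ≤ (J : ℝ) * (8 * J) := by
            have : (M : ℝ) ≤ J := by exact_mod_cast hJM.le
            exact mul_le_mul_of_nonneg_right this (by positivity)
        _ = 8 * (J : ℝ) ^ 2 := by ring
    have h2 : 0 ≤ 36 * max 0 (QFun ((M : ℝ) - 1 - Rb)) := by positivity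
    rw [← hJreal]
    linarith

/-- **(6.16) (up to constants).** For `N ≥ 0` (and any `R̄`),
`∫_{Λ_N} q(|x| - R̄)² dx ≤ 8(⌈2R̄⌉ + 4)² + 36 Q(N - R̄)⁺`
(printed: `≤ 16R̄² + 32 Q(n̄ - R̄)` for `n̄ ≥ 2R̄`, by "`∫_{Λ_n̄} dx q(|x|-R̄)² ≤ ∫₀^{2R̄} ds 8s +
∫_{R̄}^{n̄-R̄} ds 8(s+R̄) q(s)²`", `q ≤ 1`, `R̄ ≤ s`, `s q(s) ≤ 2`; here with square shells).
[cite: Richthammer2007, §6.8 (6.16) (p. 17)] -/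
theorem lintegral_box_qFun_sq_le (Rb : ℝ) {N : ℝ} (hN : 0 ≤ N) :
    ∫⁻ x in box N, ENNReal.ofReal (qFun (supNorm x - Rb) ^ 2) ∂volume ≤
      ENNReal.ofReal (8 * ((⌈2 * Rb⌉₊ : ℝ) + 4) ^ 2 + 36 * max 0 (QFun (N - Rb))) := by
  set M : ℕ := ⌊N⌋₊ + 1 with hM
  have hMN : N < M := by rw [hM]; push_cast; exact Nat.lt_floor_add_one N
  have hM1 : (M : ℝ) - 1 ≤ N := by rw [hM]; push_cast; linarith [Nat.floor_le hN]
  -- pointwise: `q(|x| - R̄)² ≤ ∑_{j<M} 1_{shell j}(x) q(j - R̄)²` on `Λ_N`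
  set g : ℕ → ℝ≥0∞ := fun j => ENNReal.ofReal (qFun ((j : ℝ) - Rb) ^ 2) with hg
  have hpt : ∀ x ∈ box N, ENNReal.ofReal (qFun (supNorm x - Rb) ^ 2) ≤
      ∑ j ∈ Finset.range M, (shell j).indicator (fun _ => g j) x := by
    intro x hx
    set j₀ : ℕ := ⌊supNorm x⌋₊ with hj₀
    have hs0 : 0 ≤ supNorm x := supNorm_nonneg x
    have hxj : x ∈ shell j₀ := ⟨Nat.floor_le hs0, Nat.lt_floor_add_one _⟩
    have hj₀M : j₀ ∈ Finset.range M := by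
      rw [Finset.mem_range, hj₀, hM]
      have : supNorm x ≤ N := supNorm_le_of_mem_box hN hx
      exact Nat.lt_succ_of_le (Nat.floor_le_floor this)
    have hle : ENNReal.ofReal (qFun (supNorm x - Rb) ^ 2) ≤ g j₀ := by
      rw [hg]
      refine ENNReal.ofReal_le_ofReal ?_
      have h1 : qFun (supNorm x - Rb) ≤ qFun ((j₀ : ℝ) - Rb) :=
        qFun_antitone (sub_le_sub_right (Nat.floor_le hs0) _)
      have h0 := (qFun_pos (supNorm x - Rb)).le
      nlinarith
    calc ENNReal.ofReal (qFun (supNorm x - Rb) ^ 2) ≤ g j₀ := hle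
      _ = (shell j₀).indicator (fun _ => g j₀) x := by rw [Set.indicator_of_mem hxj]
      _ ≤ ∑ j ∈ Finset.range M, (shell j).indicator (fun _ => g j) x :=
          Finset.single_le_sum (f := fun j => (shell j).indicator (fun _ => g j) x)
            (fun j _ => zero_le) hj₀M
  -- integrate
  have hmeas : ∀ j : ℕ, Measurable fun x : E2 => (shell j).indicator (fun _ => g j) x :=
    fun j => measurable_const.indicator (measurableSet_shell j)
  calc ∫⁻ x in box N, ENNReal.ofReal (qFun (supNorm x - Rb) ^ 2) ∂volume
      ≤ ∫⁻ x in box N, ∑ j ∈ Finset.range M, (shell j).indicator (fun _ => g j) x ∂volume :=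
        setLIntegral_mono (Finset.measurable_sum _ fun j _ => hmeas j) hpt
    _ ≤ ∫⁻ x, ∑ j ∈ Finset.range M, (shell j).indicator (fun _ => g j) x ∂volume :=
        setLIntegral_le_lintegral _ _
    _ = ∑ j ∈ Finset.range M, g j * volume (shell j) := by
        rw [lintegral_finsetSum' _ fun j _ => (hmeas j).aemeasurable]
        refine Finset.sum_congr rfl fun j _ => ?_
        rw [lintegral_indicator (measurableSet_shell j), setLIntegral_const]
    _ ≤ ∑ j ∈ Finset.range M, g j * ENNReal.ofReal (8 * j + 4) := by
        gcongr with j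
        exact volume_shell_le j
    _ = ENNReal.ofReal (∑ j ∈ Finset.range M, (8 * (j : ℝ) + 4) * qFun (j - Rb) ^ 2) := by
        rw [ENNReal.ofReal_sum_of_nonneg fun j _ => by positivity]
        refine Finset.sum_congr rfl fun j _ => ?_
        rw [hg, ← ENNReal.ofReal_mul (sq_nonneg _), mul_comm]
    _ ≤ ENNReal.ofReal (8 * ((⌈2 * Rb⌉₊ : ℝ) + 4) ^ 2 + 36 * max 0 (QFun ((M : ℝ) - 1 - Rb))) :=
        ENNReal.ofReal_le_ofReal (sum_shell_qFun_sq_le Rb M)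
    _ ≤ ENNReal.ofReal (8 * ((⌈2 * Rb⌉₊ : ℝ) + 4) ^ 2 + 36 * max 0 (QFun (N - Rb))) := by
        refine ENNReal.ofReal_le_ofReal ?_
        have : QFun ((M : ℝ) - 1 - Rb) ≤ QFun (N - Rb) := QFun_mono (by linarith)
        have : max 0 (QFun ((M : ℝ) - 1 - Rb)) ≤ max 0 (QFun (N - Rb)) := max_le_max le_rfl this
        linarith

/-! ### (6.17) -/

/-- `c(N) := Q(N - R̄)⁻² ∫_{Λ_N} q(|x| - R̄)² dx` (Richthammer 2007, (6.17), with `n̄ = N`).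
[cite: Richthammer2007, §6.8 (6.17) (p. 17)] -/
def cFun (Rb N : ℝ) : ℝ≥0∞ :=
  ENNReal.ofReal (1 / QFun (N - Rb) ^ 2) * ∫⁻ x in box N, ENNReal.ofReal (qFun (supNorm x - Rb) ^ 2) ∂volume

/-- **(6.17): `lim_{n → ∞} c(n) = 0`**, "a consequence of `log log n ≤ Q(n)`". [cite: Richthammer2007, §6.8 (6.17) (p. 17)] -/
theorem tendsto_cFun_zero (Rb : ℝ) : Tendsto (cFun Rb) atTop (𝓝 0) := by
  set A : ℝ := 8 * ((⌈2 * Rb⌉₊ : ℝ) + 4) ^ 2 with hA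
  have hA0 : 0 ≤ A := by positivity
  -- `Q(N - R̄) → ∞`
  have hQ : Tendsto (fun N : ℝ => QFun (N - Rb)) atTop atTop :=
    tendsto_QFun_atTop.comp (tendsto_atTop_add_const_right _ _ tendsto_id)
  -- the real majorant tends to `0`
  have hmaj : Tendsto (fun N : ℝ => A / QFun (N - Rb) ^ 2 + 36 / QFun (N - Rb)) atTop (𝓝 0) := by
    have h1 : Tendsto (fun N : ℝ => A / QFun (N - Rb) ^ 2) atTop (𝓝 0) := by
      have hsq : Tendsto (fun N : ℝ => QFun (N - Rb) ^ 2) atTop atTop :=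
        (tendsto_pow_atTop two_ne_zero).comp hQ
      exact tendsto_const_nhds.div_atTop hsq
    have h2 : Tendsto (fun N : ℝ => 36 / QFun (N - Rb)) atTop (𝓝 0) :=
      tendsto_const_nhds.div_atTop hQ
    simpa using h1.add h2
  -- squeeze in `ℝ≥0∞`
  have hev : ∀ᶠ N : ℝ in atTop, cFun Rb N ≤ ENNReal.ofReal (A / QFun (N - Rb) ^ 2 + 36 / QFun (N - Rb)) := by
    filter_upwards [eventually_ge_atTop (Rb + 1), eventually_ge_atTop (0 : ℝ)] with N hN hN0
    have hQpos : 0 < QFun (N - Rb) := QFun_pos (by linarith)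
    have hint := lintegral_box_qFun_sq_le Rb hN0
    rw [max_eq_right hQpos.le] at hint
    calc cFun Rb N ≤ ENNReal.ofReal (1 / QFun (N - Rb) ^ 2) * ENNReal.ofReal (A + 36 * QFun (N - Rb)) :=
          mul_le_mul' le_rfl hint
      _ = ENNReal.ofReal (A / QFun (N - Rb) ^ 2 + 36 / QFun (N - Rb)) := by
          rw [← ENNReal.ofReal_mul (by positivity)]
          congr 1
          field_simp
  refine tendsto_of_tendsto_of_tendsto_of_le_of_le' tendsto_const_nhds ?_
    (Eventually.of_forall fun N => zero_le) hev
  rw [← ENNReal.ofReal_zero]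
  exact ENNReal.tendsto_ofReal hmaj

/-! ### (6.18) -/

/-- **(6.18)**: if `|a - b| ≤ m c` (e.g. `a = |x_m|`, `b = |x₀|` for a chain `x₀, …, x_m` with steps
of maximum norm `≤ c = c_K`), then `(a - b + c)² ≤ (m+1)² c²`. [cite: Richthammer2007, §6.8 (6.18) (p. 17)] -/
theorem sq_sub_add_le {a b c : ℝ} {m : ℕ} (hc : 0 ≤ c) (h : |a - b| ≤ m * c) :
    (a - b + c) ^ 2 ≤ ((m : ℝ) + 1) ^ 2 * c ^ 2 := by
  have h1 := (abs_le.1 h).1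
  have h2 := (abs_le.1 h).2
  have hlo : -(((m : ℝ) + 1) * c) ≤ a - b + c := by nlinarith
  have hhi : a - b + c ≤ ((m : ℝ) + 1) * c := by linarith
  calc (a - b + c) ^ 2 ≤ (((m : ℝ) + 1) * c) ^ 2 := sq_le_sq' hlo hhi
    _ = ((m : ℝ) + 1) ^ 2 * c ^ 2 := by ring

end Literature.Barriers.AtomisticToContinuum.HardDisk

end
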